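import Literature.NumberTheory.Automorphic.BrandtXi
import HarnessLib

/-!
# Orders as ideals of themselves; left orders of full lattices are orders

Topic `NumberTheory/Automorphic`; theorems only, about the order/ideal layer of
`Literature/NumberTheory/Automorphic/BrandtXi.lean` (`Brandt.IsOrder`, `Brandt.leftOrder`,
`Brandt.rightOrder`, `Brandt.IsInvertible`, `Brandt.rightIdeals`, `Brandt.ClassSet`; Voight, GTM 288,
Ch. 10, 16, 17):

* `Brandt.IsOrder.rightOrder_eq`, `leftOrder_eq`, `mul_self`, `isInvertible`, `mem_rightIdeals` :
  an order `O` is its own left and right order, `O O = O`, `O` is invertible (with `O' = O`), hence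
  `O ∈ rightIdeals O` — **the trivial class** `[O] ∈ Cls O` (Voight 16.2, 17.3), so
  `Brandt.IsOrder.nonempty_classSet` and, for Brandt setups, `XiSetup.nonempty_classSet`,
  `XiSetup.card_classSet_pos` (the class number is `≥ 1`);
* `Brandt.isOrder_leftOrder` : **the left order `O_L(I)` of a full `ℤ`-lattice `I` is an order**
  (Voight Lemma 10.2.7): it contains `1`, is multiplicatively closed, finitely generated (`n O_L(I) ⊆ I`
  for `n ≠ 0` with `n · 1 ∈ I`) and full (`k d ∈ O_L(I)` for a common multiple `k` of the
  denominators of `d g`, `g` running over generators of `I`); for setups `XiSetup.isOrder_leftOrder_rep`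
  — the weights `w_c = #O_L(I_c)ˣ/2` of `BrandtXi.lean` are unit indices of genuine orders.

By-product of the audit of `PollackWeston2011.thm_6_8_ellipticCurve` (triaged XL, not discharged).

## References

* J. Voight, *Quaternion Algebras*, GTM 288 (2021), Lemma 10.2.7, §16.2, §16.5, §17.3 [Voight2021].
-/

noncomputable section

open scoped Pointwise

universe u

namespace Literature.NumberTheory.Automorphic

namespace Brandt

variable {D : Type u} [Ring D]

/-! ### An order is a (two-sided, invertible) ideal of itself -/

/-- The right order of an order `O` is `O` itself (`1 ∈ O` and `O O ⊆ O`). [cite: Voight2021, §16.2] -/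
theorem IsOrder.rightOrder_eq {O : Submodule ℤ D} (hO : IsOrder D O) : rightOrder O = O := by
  ext x
  rw [mem_rightOrder_iff]
  constructor
  · intro h
    simpa using h 1 hO.one_mem
  · intro hx m hm
    exact hO.mul_mem m hm x hx

/-- The left order of an order `O` is `O` itself. [cite: Voight2021, §16.2] -/
theorem IsOrder.leftOrder_eq {O : Submodule ℤ D} (hO : IsOrder D O) : leftOrder O = O := by
  ext x
  rw [mem_leftOrder_iff]
  constructor
  · intro h
    simpa using h 1 hO.one_mem
  · intro hx m hm
    exact hO.mul_mem x hx m hm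

/-- `O O = O` for an order `O`. [cite: Voight2021, §16.2] -/
theorem IsOrder.mul_self {O : Submodule ℤ D} (hO : IsOrder D O) : O * O = O := by
  refine le_antisymm (Submodule.mul_le.mpr fun a ha b hb => hO.mul_mem a ha b hb) fun x hx => ?_
  simpa using Submodule.mul_mem_mul hO.one_mem hx

/-- An order is an invertible lattice, with quasi-inverse itself (Voight Def. 16.5.1 with
`I = I' = O`). [cite: Voight2021, Def. 16.5.1] -/
theorem IsOrder.isInvertible {O : Submodule ℤ D} (hO : IsOrder D O) : IsInvertible D O :=
  ⟨O, hO.isFullLattice, by rw [hO.mul_self, hO.leftOrder_eq],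
    by rw [hO.leftOrder_eq, hO.rightOrder_eq], by rw [hO.mul_self, hO.rightOrder_eq],
    by rw [hO.leftOrder_eq, hO.rightOrder_eq]⟩

/-- **An order is an invertible right ideal of itself**: `O ∈ rightIdeals O`. [cite: Voight2021, §17.3] -/
theorem IsOrder.mem_rightIdeals {O : Submodule ℤ D} (hO : IsOrder D O) : O ∈ rightIdeals O :=
  ⟨hO.isFullLattice, hO.rightOrder_eq, hO.isInvertible⟩

/-- **The trivial class**: the class set of an order is non-empty, `[O] ∈ Cls O`
(Voight §17.3). [cite: Voight2021, §17.3] -/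
theorem IsOrder.nonempty_classSet {O : Submodule ℤ D} (hO : IsOrder D O) : Nonempty (ClassSet O) :=
  ⟨Quotient.mk (rightClassSetoid O) ⟨O, hO.mem_rightIdeals⟩⟩

/-! ### The left order of a full lattice is an order -/

/-- `n O_L(I) ⊆ I` whenever `n · 1 ∈ I`. [folklore] -/
theorem zsmul_mem_of_mem_leftOrder {I : Submodule ℤ D} {n : ℤ} (hn1 : n • (1 : D) ∈ I) {x : D}
    (hx : x ∈ leftOrder I) : n • x ∈ I := by
  have := hx _ hn1
  rwa [mul_smul_comm, mul_one] at this

/-- The left order of a full lattice is finitely generated (additively torsion-free `D`): with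
`n ≠ 0`, `n · 1 ∈ I`, multiplication by `n` embeds `O_L(I)` into the finitely generated `I`.
[cite: Voight2021, Lemma 10.2.7] -/
theorem fg_leftOrder [IsAddTorsionFree D] {I : Submodule ℤ D} (hI : IsFullLattice D I) :
    (leftOrder I).FG := by
  obtain ⟨n, hn, hn1⟩ := hI.2 1
  let f : D →ₗ[ℤ] D := DistribSMul.toLinearMap ℤ D n
  have hf : Function.Injective f := by
    intro x y hxy
    have h : n • x = n • y := hxy
    exact smul_right_injective D hn h
  refine Submodule.fg_of_fg_map_injective f hf (Submodule.FG.of_le hI.1 ?_)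
  rintro _ ⟨x, hx, rfl⟩
  exact zsmul_mem_of_mem_leftOrder hn1 hx

/-- The left order of a full lattice is full: for every `d ∈ D` some non-zero integer multiple
`k d` satisfies `(k d) I ⊆ I` (take `k` a common multiple, over generators `g` of `I`, of integers
`k_g` with `k_g (d g) ∈ I`). [cite: Voight2021, Lemma 10.2.7] -/
theorem exists_zsmul_mem_leftOrder {I : Submodule ℤ D} (hI : IsFullLattice D I) (d : D) :
    ∃ k : ℤ, k ≠ 0 ∧ k • d ∈ leftOrder I := by
  classical
  obtain ⟨t, ht⟩ := hI.1
  choose k hk hkmem using fun g : D => hI.2 (d * g)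
  refine ⟨∏ g ∈ t, k g, Finset.prod_ne_zero_iff.mpr fun g _ => hk g, ?_⟩
  -- `(K • d) * x ∈ I` for all `x ∈ I = span t`, by induction on the span
  intro x hx
  rw [← ht] at hx
  induction hx using Submodule.span_induction with
  | mem g hg =>
    rw [smul_mul_assoc, ← Finset.prod_erase_mul _ _ hg, mul_smul]
    exact I.smul_mem _ (hkmem g)
  | zero => rw [mul_zero]; exact I.zero_mem
  | add x y _ _ hx hy => rw [mul_add]; exact I.add_mem hx hy
  | smul m x _ hx => rw [mul_smul_comm]; exact I.smul_mem _ hx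

/-- **The left order of a full `ℤ`-lattice is an order** (Voight Lemma 10.2.7), for `D` additively
torsion-free (e.g. an algebra over a field of characteristic zero). [cite: Voight2021, Lemma 10.2.7] -/
theorem isOrder_leftOrder [IsAddTorsionFree D] {I : Submodule ℤ D} (hI : IsFullLattice D I) :
    IsOrder D (leftOrder I) where
  one_mem := one_mem_leftOrder I
  mul_mem _ ha _ hb := mul_mem_leftOrder ha hb
  isFullLattice := ⟨fg_leftOrder hI, exists_zsmul_mem_leftOrder hI⟩

/-! ### Brandt setups -/

variable {Nplus Nminus : ℕ}

/-- The class set of a Brandt setup is non-empty (it contains the trivial class `[O]`). [cite: Voight2021, §17.3] -/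
theorem XiSetup.nonempty_classSet (S : XiSetup Nplus Nminus) : Nonempty (ClassSet S.O) :=
  S.isEichlerOrder.isOrder.nonempty_classSet

/-- The class number of a Brandt setup is positive. [cite: Voight2021, §17.3] -/
theorem XiSetup.card_classSet_pos (S : XiSetup Nplus Nminus) [Fintype (ClassSet S.O)] :
    0 < Fintype.card (ClassSet S.O) :=
  haveI := S.nonempty_classSet
  Fintype.card_pos

/-- The algebra of a Brandt setup is additively torsion-free (it is a `ℚ`-vector space). [folklore] -/
theorem XiSetup.isAddTorsionFree (S : XiSetup Nplus Nminus) : IsAddTorsionFree S.D :=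
  isAddTorsionFree_of_charZero_module ℚ S.D

/-- **The left orders `O_L(I_c)` of a Brandt setup are orders**, so the weights
`w_c = #O_L(I_c)ˣ / 2` of `BrandtXi.lean` are unit indices of genuine `ℤ`-orders
(Voight Lemma 10.2.7 with 41.1.3). [cite: Voight2021, Lemma 10.2.7] -/
theorem XiSetup.isOrder_leftOrder_rep (S : XiSetup Nplus Nminus) (c : ClassSet S.O) :
    IsOrder S.D (leftOrder c.rep) :=
  haveI := S.isAddTorsionFree
  isOrder_leftOrder c.rep_mem.1

end Brandt

end Literature.NumberTheory.Automorphic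

end
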